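import Summits.NavierStokesRegularity.NavierStokesRegularity.Theorems.TargetDepletionLadderPalinstrophyIdentityC1
import Literature.Analysis.FluidPDE.DivCurlL2
import HarnessLib

/-!
# Crux `Target` (stmt-NavierStokesRegularity-1217), line `depletion_ladder`, stub S1: the `L²` div–curl
# ESTIMATE for `C¹` fields — `DW ∈ L²` from `W, curl W ∈ L²`, `div W = 0` (no a priori `DW ∈ L²`)

`--supports stmt-NavierStokesRegularity-1217` (seat leafhand-ns-poloidalwindowdoor-2 g1, cell decomp-ns;
third file after `…PalinstrophyIdentityC1` (p817198) and `…AlignmentLawsC2` (p817244)).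

`…PalinstrophyIdentityC1.integral_norm_curl_sq_eq_of_contDiff_one` gives `‖curl W‖₂ = ‖DW‖₂` for a
`C¹` divergence-free `W` ASSUMING `DW ∈ L²`. Here the assumption is earned: the tree's estimate
`lintegral_frobeniusNormSq_fderiv_le_lintegral_sq_norm_curl` (`∫|Dv|² ≤ ∫|curl v|²` for `v ∈ C² ∩ L²`
divergence free, NO a priori integrability of `Dv`) is lowered to `C¹`:

* `integral_fderiv_apply_convect_eq_neg` — second integration by parts for `C¹` fields:
  `∫ Dψ (DW W) = −∫ D²ψ (W, W)` for `W ∈ C¹` divergence free and `ψ ∈ C²_c` (divergence theorem for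
  the `C¹_c` field `(Dψ·W) W`).
* `integral_cutoff_mul_frobeniusNormSq_eq` — with the weak identity of p817198:
  `∫ χ (|DW|²_F − ‖curl W‖²) = ∫ D²χ (W, W)` for every `χ ∈ C²_c`.
* `integrable_frobeniusNormSq_fderiv_of_contDiff_one` — **`W ∈ C¹ ∩ L²`, `div W = 0`, `curl W ∈ L²`
  ⟹ `DW ∈ L²`** (radial cut-offs `cutoff R` with `‖D²χ_R‖ ≤ C/R²`: `∫ χ_R|DW|² ≤ ‖curl W‖₂² + C‖W‖₂²/R²`,
  exhaustion `lintegral_ofReal_le_of_forall_integral_cutoff_mul_le`), and then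
  `integral_frobeniusNormSq_fderiv_eq_of_contDiff_one`: `∫|DW|²_F = ∫‖curl W‖²`.
* `integrable_frobeniusNormSq_fderiv_curl_of_contDiff_two` — registered-class reading: for `u ∈ C²`
  with `ω = curl u ∈ L²` and `curl ω ∈ L²`, `∇ω ∈ L²` with `‖∇ω‖₂ = ‖curl ω‖₂`; so in the registered
  `StretchingDepletion` binders the hypothesis `|∇ω|_F ∈ L²` is equivalent to `curl ω = −Δu ∈ L²`.

Use (successor programme for S1 as registered): after the Liouville representation `u = c + K₃ ∗ ω`
gives `∂ₖu ∈ L²`, this file applied to `W = ∂ₖu ∈ C¹` yields `D²u ∈ L²` with `‖D∂ₖu‖₂ = ‖∂ₖω‖₂` — the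
second of the two `L²` identities the strain-cube chain needs, in the `C²` class.
HONEST LABEL: helper; closes no stub; no Navier–Stokes content; `Target`, S3, NS regularity OPEN.
References: Galdi 2011 §II.6; Sohr 2001 Lemma II.2.5.x (`‖∇v‖₂ ≤ ‖curl v‖₂ + ‖div v‖₂`). [folklore]
-/

noncomputable section

-- the summit and its single sub-problem share the name (CONVENTIONS §1)
set_option linter.dupNamespace false

open Set Filter Topology MeasureTheory Metric
open scoped RealInnerProductSpace
open Literature.Analysis.FluidPDE

namespace Summit.NavierStokesRegularity.NavierStokesRegularity.Theorems.DepletionLadder.C1DivCurl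

variable {W : EuclideanSpace ℝ (Fin 3) → EuclideanSpace ℝ (Fin 3)}

/-- **Second integration by parts for `C¹` fields.** For `W ∈ C¹(ℝ³; ℝ³)` divergence free and a
compactly supported `ψ ∈ C²`: `∫ Dψ (DW W) = −∫ D²ψ (W, W)` — the divergence theorem without boundary
for the `C¹_c` field `Z = (Dψ·W) W`, `div Z = D²ψ(W, W) + Dψ(DW W) + (Dψ·W) div W`. [folklore] -/
theorem integral_fderiv_apply_convect_eq_neg (hW : ContDiff ℝ 1 W) (hdiv : VectorCalculus.IsDivFree W)
    {ψ : EuclideanSpace ℝ (Fin 3) → ℝ} (hψ : ContDiff ℝ 2 ψ) (hψc : HasCompactSupport ψ) :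
    ∫ x, fderiv ℝ ψ x (fderiv ℝ W x (W x)) =
      -∫ x, fderiv ℝ (fderiv ℝ ψ) x (W x) (W x) := by
  have hWd : Differentiable ℝ W := hW.differentiable one_ne_zero
  have hDψ : ContDiff ℝ 1 (fderiv ℝ ψ) := hψ.fderiv_right (m := 1) le_rfl
  have hDψd : Differentiable ℝ (fderiv ℝ ψ) := hDψ.differentiable one_ne_zero
  -- the scalar `c = Dψ·W` and the field `Z = c W`
  set c : EuclideanSpace ℝ (Fin 3) → ℝ := fun x => fderiv ℝ ψ x (W x) with hcdef
  have hcC : ContDiff ℝ 1 c := hDψ.clm_apply hW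
  have hcd : Differentiable ℝ c := hcC.differentiable one_ne_zero
  have hcs : HasCompactSupport c := (hψc.fderiv (𝕜 := ℝ)).mono fun x hx => by
    contrapose! hx
    simp only [Function.mem_support, not_not] at hx
    simp [hcdef, hx]
  have hZC : ContDiff ℝ 1 fun x => c x • W x := hcC.smul hW
  have hZs : HasCompactSupport fun x => c x • W x := hcs.smul_right
  have h0 := integral_divergence_eq_zero hZC hZs
  -- pointwise divergence of `Z`
  have hDc : ∀ x, fderiv ℝ c x (W x) =
      fderiv ℝ (fderiv ℝ ψ) x (W x) (W x) + fderiv ℝ ψ x (fderiv ℝ W x (W x)) := by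
    intro x
    rw [hcdef, fderiv_clm_apply (hDψd x) (hWd x)]
    simp only [FunLike.coe_add, Pi.add_apply, ContinuousLinearMap.comp_apply,
      ContinuousLinearMap.flip_apply]
    ring
  have hpt : ∀ x, VectorCalculus.divergence (fun y => c y • W y) x =
      fderiv ℝ (fderiv ℝ ψ) x (W x) (W x) + fderiv ℝ ψ x (fderiv ℝ W x (W x)) := by
    intro x
    rw [divergence_smul_apply (hcd x) (hWd x), hdiv x, mul_zero, zero_add, real_inner_comm,
      gradient, InnerProductSpace.toDual_symm_apply, hDc x]
  -- integrability (continuous, compact support inside that of `Dψ`)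
  have hi1 : Integrable fun x => fderiv ℝ (fderiv ℝ ψ) x (W x) (W x) := by
    refine (((hDψ.continuous_fderiv one_ne_zero).clm_apply hW.continuous).clm_apply hW.continuous)
      |>.integrable_of_hasCompactSupport
        (((hψc.fderiv (𝕜 := ℝ)).fderiv (𝕜 := ℝ)).mono fun x hx => ?_)
    contrapose! hx
    have h : fderiv ℝ (fderiv ℝ ψ) x = 0 := by simpa [Function.mem_support] using hx
    simp [h]
  have hi2 : Integrable fun x => fderiv ℝ ψ x (fderiv ℝ W x (W x)) := by
    refine ((hψ.continuous_fderiv (by norm_num)).clm_apply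
      ((hW.continuous_fderiv one_ne_zero).clm_apply hW.continuous))
      |>.integrable_of_hasCompactSupport ((hψc.fderiv (𝕜 := ℝ)).mono fun x hx => ?_)
    contrapose! hx
    have h : fderiv ℝ ψ x = 0 := by simpa [Function.mem_support] using hx
    simp [h]
  simp_rw [hpt] at h0
  rw [integral_add hi1 hi2] at h0
  linarith

/-- **The cut-off energy identity for `C¹` fields.** For `W ∈ C¹` divergence free and `χ ∈ C²_c`:
`∫ χ (|DW|²_F − ‖curl W‖²) = ∫ D²χ (W, W)` (weak identity of p817198 and the second integration by
parts). [folklore] -/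
theorem integral_mul_frobeniusNormSq_sub_eq_hessian (hW : ContDiff ℝ 1 W)
    (hdiv : VectorCalculus.IsDivFree W) {χ : EuclideanSpace ℝ (Fin 3) → ℝ} (hχ : ContDiff ℝ 2 χ)
    (hχc : HasCompactSupport χ) :
    ∫ x, χ x * (frobeniusNormSq (fderiv ℝ W x) - ‖curl W x‖ ^ 2) =
      ∫ x, fderiv ℝ (fderiv ℝ χ) x (W x) (W x) := by
  rw [integral_mul_frobeniusNormSq_sub_norm_curl_sq_eq hW hdiv (hχ.of_le one_le_two) hχc,
    integral_fderiv_apply_convect_eq_neg hW hdiv hχ hχc, neg_neg]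

/-- **The `L²` div–curl estimate for `C¹` fields.** For `W ∈ C¹(ℝ³; ℝ³)` divergence free with
`W ∈ L²` and `curl W ∈ L²`, the full gradient is square integrable: `|DW|²_F ∈ L¹`. Proof: with the
radial cut-offs `χ_R = cutoff R` (`‖D²χ_R‖ ≤ C/R²` on `|x| ≤ 2R`),
`∫ χ_R |DW|²_F = ∫ χ_R ‖curl W‖² + ∫ D²χ_R(W, W) ≤ ‖curl W‖₂² + (C/R²)‖W‖₂²`, and exhaustion.
[folklore] -/
theorem integrable_frobeniusNormSq_fderiv_of_contDiff_one (hW : ContDiff ℝ 1 W)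
    (hdiv : VectorCalculus.IsDivFree W) (hL2 : Integrable fun x => ‖W x‖ ^ 2)
    (hC : Integrable fun x => ‖curl W x‖ ^ 2) :
    Integrable fun x => frobeniusNormSq (fderiv ℝ W x) := by
  set S : EuclideanSpace ℝ (Fin 3) → ℝ := fun x => frobeniusNormSq (fderiv ℝ W x) with hS
  have hSc : Continuous S := continuous_frobeniusNormSq_fderiv hW one_ne_zero
  have hS0 : ∀ x, 0 ≤ S x := fun x => frobeniusNormSq_nonneg _
  have hCuc : Continuous fun x => ‖curl W x‖ ^ 2 := by
    have : Continuous (curl W) := by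
      rw [curl_eq_curlCLM_comp]; exact curlCLM.continuous.comp (hW.continuous_fderiv one_ne_zero)
    exact (continuous_norm.comp this).pow 2
  obtain ⟨C₂, hC₂0, hC₂⟩ := exists_norm_fderiv_fderiv_cutoff_le_indicator (E := EuclideanSpace ℝ (Fin 3))
  set M : ℝ := ∫ x, ‖curl W x‖ ^ 2 with hM
  set N : ℝ := ∫ x, ‖W x‖ ^ 2 with hN
  -- the cut-off bound
  have hbound : ∀ R : ℝ, 1 ≤ R → ∫ x, cutoff R x * S x ≤ M + C₂ * N / R ^ 2 := by
    intro R hR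
    have hR0 : 0 < R := by linarith
    have hχ : ContDiff ℝ 2 (cutoff (E := EuclideanSpace ℝ (Fin 3)) R) := contDiff_cutoff R
    have hχc : HasCompactSupport (cutoff (E := EuclideanSpace ℝ (Fin 3)) R) := hasCompactSupport_cutoff hR0
    have hid := integral_mul_frobeniusNormSq_sub_eq_hessian hW hdiv hχ hχc
    have hiS : Integrable fun x => cutoff R x * S x :=
      (hχ.continuous.mul hSc).integrable_of_hasCompactSupport hχc.mul_right
    have hiC : Integrable fun x => cutoff R x * ‖curl W x‖ ^ 2 :=
      (hχ.continuous.mul hCuc).integrable_of_hasCompactSupport hχc.mul_right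
    have hsplit : ∫ x, cutoff R x * S x =
        (∫ x, cutoff R x * ‖curl W x‖ ^ 2) + ∫ x, cutoff R x * (S x - ‖curl W x‖ ^ 2) := by
      rw [← integral_add hiC (hiS.sub hiC |>.congr ?_)]
      · exact integral_congr_ae (ae_of_all _ fun x => by ring)
      · exact ae_of_all _ fun x => by simp only [Pi.sub_apply]; ring
    -- first piece `≤ M`
    have h1 : ∫ x, cutoff R x * ‖curl W x‖ ^ 2 ≤ M := by
      refine integral_mono_of_nonneg (ae_of_all _ fun x => ?_) hC (ae_of_all _ fun x => ?_)
      · exact mul_nonneg (cutoff_nonneg R x) (sq_nonneg _)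
      · exact mul_le_of_le_one_left (sq_nonneg _) (cutoff_le_one R x)
    -- second piece `≤ C₂ N / R²`
    have h2 : ∫ x, cutoff R x * (S x - ‖curl W x‖ ^ 2) ≤ C₂ * N / R ^ 2 := by
      rw [hid]
      have hdom : Integrable fun x => C₂ / R ^ 2 * ‖W x‖ ^ 2 := hL2.const_mul _
      have hχ3 : ContDiff ℝ 3 (cutoff (E := EuclideanSpace ℝ (Fin 3)) R) := contDiff_cutoff R
      have hD2c : Continuous (fderiv ℝ (fderiv ℝ (cutoff (E := EuclideanSpace ℝ (Fin 3)) R))) :=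
        (hχ3.fderiv_right (m := 2) (by norm_num)).continuous_fderiv (by norm_num)
      have hfi : Integrable fun x => fderiv ℝ (fderiv ℝ (cutoff R)) x (W x) (W x) := by
        refine ((hD2c.clm_apply hW.continuous).clm_apply hW.continuous)
          |>.integrable_of_hasCompactSupport (((hχc.fderiv (𝕜 := ℝ)).fderiv (𝕜 := ℝ)).mono ?_)
        intro x hx
        contrapose! hx
        have h : fderiv ℝ (fderiv ℝ (cutoff R)) x = 0 := by simpa [Function.mem_support] using hx
        simp [h]
      calc ∫ x, fderiv ℝ (fderiv ℝ (cutoff R)) x (W x) (W x)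
          ≤ ∫ x, C₂ / R ^ 2 * ‖W x‖ ^ 2 := by
            refine integral_mono hfi hdom fun x => ?_
            calc fderiv ℝ (fderiv ℝ (cutoff R)) x (W x) (W x)
                ≤ ‖fderiv ℝ (fderiv ℝ (cutoff R)) x (W x) (W x)‖ := Real.le_norm_self _
              _ ≤ ‖fderiv ℝ (fderiv ℝ (cutoff R)) x‖ * ‖W x‖ * ‖W x‖ := by
                  refine (ContinuousLinearMap.le_opNorm _ _).trans ?_
                  exact mul_le_mul_of_nonneg_right (ContinuousLinearMap.le_opNorm _ _) (norm_nonneg _)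
              _ ≤ (C₂ / R ^ 2 * (closedBall (0 : EuclideanSpace ℝ (Fin 3)) (2 * R)).indicator
                    (fun _ => (1 : ℝ)) x) * ‖W x‖ * ‖W x‖ := by
                  gcongr; exact hC₂ R hR0 x
              _ ≤ (C₂ / R ^ 2 * 1) * ‖W x‖ * ‖W x‖ := by
                  have hind : (closedBall (0 : EuclideanSpace ℝ (Fin 3)) (2 * R)).indicator
                      (fun _ => (1 : ℝ)) x ≤ 1 :=
                    Set.indicator_apply_le' (fun _ => le_rfl) (fun _ => zero_le_one)
                  have hc0 : 0 ≤ C₂ / R ^ 2 := div_nonneg hC₂0 (sq_nonneg _)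
                  have hw : 0 ≤ ‖W x‖ := norm_nonneg _
                  gcongr
              _ = C₂ / R ^ 2 * ‖W x‖ ^ 2 := by ring
        _ = C₂ / R ^ 2 * N := integral_const_mul _ _
        _ = C₂ * N / R ^ 2 := by ring
    rw [hsplit]
    linarith
  -- exhaustion
  have hg : Tendsto (fun R : ℝ => C₂ * N / R ^ 2) atTop (𝓝 0) := by
    have h := (tendsto_inv_atTop_zero.comp (tendsto_pow_atTop (n := 2) two_ne_zero)).const_mul (C₂ * N)
    rw [mul_zero] at h
    refine h.congr fun R => ?_
    simp [div_eq_mul_inv]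
  have hlin := lintegral_ofReal_le_of_forall_integral_cutoff_mul_le hSc hS0 hg hbound
  refine ⟨hSc.aestronglyMeasurable, ?_⟩
  rw [hasFiniteIntegral_iff_ofReal (ae_of_all _ hS0)]
  exact hlin.trans_lt ENNReal.ofReal_lt_top

/-- **The `L²` div–curl IDENTITY for `C¹` fields** (estimate + p817198): for `W ∈ C¹(ℝ³; ℝ³)`
divergence free with `W, curl W ∈ L²`: `∫|DW|²_F = ∫‖curl W‖²`. [folklore] -/
theorem integral_frobeniusNormSq_fderiv_eq_of_contDiff_one (hW : ContDiff ℝ 1 W)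
    (hdiv : VectorCalculus.IsDivFree W) (hL2 : Integrable fun x => ‖W x‖ ^ 2)
    (hC : Integrable fun x => ‖curl W x‖ ^ 2) :
    ∫ x, frobeniusNormSq (fderiv ℝ W x) = ∫ x, ‖curl W x‖ ^ 2 :=
  (integral_norm_curl_sq_eq_of_contDiff_one hW hdiv hL2
    (integrable_frobeniusNormSq_fderiv_of_contDiff_one hW hdiv hL2 hC)).symm

/-- ★ **Registered-class reading.** For `u ∈ C²(ℝ³; ℝ³)` with `ω = curl u ∈ L²` and `curl ω ∈ L²`:
`|∇ω|_F ∈ L²` and `∫|∇ω|²_F = ∫‖curl ω‖²` — in the binders of the registered `StretchingDepletion`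
the palinstrophy hypothesis `|∇ω|_F ∈ L²` may be traded for `curl ω (= −Δu) ∈ L²`. [folklore] -/
theorem integrable_frobeniusNormSq_fderiv_curl_of_contDiff_two
    {u : EuclideanSpace ℝ (Fin 3) → EuclideanSpace ℝ (Fin 3)} (hu : ContDiff ℝ 2 u)
    (iZ : Integrable (fun x => ‖curl u x‖ ^ 2))
    (iC : Integrable (fun x => ‖curl (curl u) x‖ ^ 2)) :
    Integrable (fun x => frobeniusNormSq (fderiv ℝ (curl u) x)) ∧
      ∫ x, frobeniusNormSq (fderiv ℝ (curl u) x) = ∫ x, ‖curl (curl u) x‖ ^ 2 :=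
  ⟨integrable_frobeniusNormSq_fderiv_of_contDiff_one (contDiff_one_curl_of_contDiff_two hu)
      (fun x => divergence_curl_eq_zero_holds u hu x) iZ iC,
    integral_frobeniusNormSq_fderiv_eq_of_contDiff_one (contDiff_one_curl_of_contDiff_two hu)
      (fun x => divergence_curl_eq_zero_holds u hu x) iZ iC⟩

/-! ## Appendix (same seat): the cut-off energy identity is Galilean -/

/-- **The cut-off energy identity is Galilean.** For `W ∈ C¹(ℝ³; ℝ³)` divergence free, `χ ∈ C²_c` and
ANY constant `c`: `∫ χ (|DW|²_F − ‖curl W‖²) = ∫ D²χ (W − c, W − c)` — the terms linear and constant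
in `c` integrate to zero (`∫ ∂ᵢ∂ⱼχ = 0`, and `∫ ∂ⱼχ · div W = 0`). This is the mechanism by which the
whole-space `L²` div–curl identity needs NO decay of `W`, only `DW ∈ L²`: with `c = ` the mean of `W`
on the shell `{R ≤ |x| ≤ 2R}` and Poincaré's inequality there, `|∫ D²χ_R (W − c, W − c)| ≤ C ∫_{shell} |DW|²`
(the Poincaré step is NOT in this file). [folklore] -/
theorem integral_mul_frobeniusNormSq_sub_eq_hessian_sub_const (hW : ContDiff ℝ 1 W)
    (hdiv : VectorCalculus.IsDivFree W) {χ : EuclideanSpace ℝ (Fin 3) → ℝ} (hχ : ContDiff ℝ 2 χ)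
    (hχc : HasCompactSupport χ) (c : EuclideanSpace ℝ (Fin 3)) :
    ∫ x, χ x * (frobeniusNormSq (fderiv ℝ W x) - ‖curl W x‖ ^ 2) =
      ∫ x, fderiv ℝ (fderiv ℝ χ) x (W x - c) (W x - c) := by
  have hD : fderiv ℝ (fun y => W y - c) = fderiv ℝ W := by
    funext x
    exact fderiv_sub_const c
  have hW' : ContDiff ℝ 1 (fun y => W y - c) := hW.sub contDiff_const
  have hdiv' : VectorCalculus.IsDivFree (fun y => W y - c) := fun x => by
    have h := hdiv x
    simp only [VectorCalculus.divergence] at h ⊢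
    rw [hD]
    exact h
  have h := integral_mul_frobeniusNormSq_sub_eq_hessian hW' hdiv' hχ hχc
  have hcurl : ∀ x, curl (fun y => W y - c) x = curl W x := fun x => by
    simp only [curl, hD]
  simp only [hD, hcurl] at h
  exact h

end Summit.NavierStokesRegularity.NavierStokesRegularity.Theorems.DepletionLadder.C1DivCurl

end
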